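import Summits.ResolutionOfSingularities.ResolutionOfSingularities.Theorems.FrobeniusLadderFInjectiveMacaulayficationX2Cubic4FloorFull
import Summits.ResolutionOfSingularities.ResolutionOfSingularities.Theorems.FrobeniusLadderFInjectiveMacaulayficationX2Cubic4VertexFull
import HarnessLib

/-!
# (RR-I2) T-INSTANCE #2 AS ONE ROW OF RECORD: `tStep_row_x2cubic4` — scope ∧ legality ∧ FULL floor ∧ instance, for EVERY prime `p ≥ 5`
# (crux `FInjectiveMacaulayfication` stmt-ResolutionOfSingularities-15315, chain w45a; pure assembly of ✓p670291/p670795 (g10 input side), ✓p676607 (instance), ✓p677842 (floor FULL),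
# ✓p678024 (vertex FULL); res-L1-w45a-plan-1 R22.3 + correction (billing: T-side row; non-vacuity only, no F-side count); seat res-L1-w45a-lead-1 g11)

[OURS · L1 W4.5a] Support file (`--supports stmt-ResolutionOfSingularities-15315 --as helper`); def-free; UNCONDITIONAL; no named fact; NOT a statement of any manuscript.
One bed; evidence for nothing beyond itself; the T″ stub `stub_localRegularizationFibreFullTr` and the F-half stay OPEN; nothing of the crux is proved. AI-written (AI review is weaker
than expert review).

`Y = Spec k[X₀..X₄]/(f)`, `f = X₄² + X₀³ + X₁³ + X₂³ + X₃³`, `p = char k` a prime `∉ {2, 3}`, `v` the vertex, `I = 𝔪̃·𝒪_{Y,v}` the point floor's centre on the germ.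
★★★ `tStep_row_x2cubic4`: (SCOPE) `v` is closed, singular, `dim 𝒪_{Y,v} = 4`, and `𝒪_{Y,v}` is FULL — so `(Y, v)` is a base germ of the T″ stub `TrFullStep.LocalRegularizationFibreFullTr p 4 ·`
(inner block `TStepGerm.TStepInstanceAt`); (LEGALITY + FULL FLOOR) every blowing up `S′ → Spec 𝒪_{Y,v}` along `I` satisfies ALL FOUR hypotheses of the inner block (`I ≠ ⊥`, admissible,
regular off the closed fibre, FULL at every stalk); (INSTANCE) `TStepInstanceAt p v I` — hence its conclusion is ASSERTED: on the actual point floor there is a fibre-supported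
`𝓚 ≠ ⊥` (the reduced singular locus, the Fermat-cubic surface `Σ`) ALL of whose blowings up are REGULAR.
[folklore assembly; cite: Fedder1983, Thm. 1.12; GortzWedhorn2020, Prop. 13.91 (2), (13.19); Temkin2008, §2.1]
-/

-- single-problem summit: the doubled namespace component is forced
set_option linter.dupNamespace false

noncomputable section

namespace Summit.ResolutionOfSingularities.ResolutionOfSingularities.Theorems.FInjectiveMacaulayfication.X2Cubic4TStepRow

open CategoryTheory CategoryTheory.Limits AlgebraicGeometry TopologicalSpace IsLocalRing MvPolynomial
open Literature.AlgebraicGeometry.Resolution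
open Summit.ResolutionOfSingularities.ResolutionOfSingularities.Theorems.FInjectiveMacaulayfication
open SliceableCentre

/-- ★★★ **T-INSTANCE #2, ROW OF RECORD** (`Y = {x² + y³ + u³ + t³ + s³} ⊂ 𝔸⁵`, every prime `p ∉ {2,3}`, every field of characteristic `p`): SCOPE (`v` closed ∧ singular ∧
`dim 𝒪_{Y,v} = 4` ∧ `FullCl p 𝒪_{Y,v}`) ∧ LEGAL-AND-FULL point floor (for every blowing up along `I = 𝔪̃·𝒪_{Y,v}`: `I ≠ ⊥` ∧ `Supp I ⊆ (Reg)ᶜ` ∧ regular off the closed fibre ∧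
FULL at every stalk) ∧ INSTANCE `TStepGerm.TStepInstanceAt p v I`. [OURS · assembly of ✓p670291 ✓p670795 ✓p676607 ✓p677842 ✓p678024] -/
theorem tStep_row_x2cubic4 (p : ℕ) [Fact p.Prime] (k : Type) [Field k] [CharP k p] (hp2 : p ≠ 2) (hp3 : p ≠ 3) (f : MvPolynomial (Fin 5) k)
    (hf : f = X 4 ^ 2 + X 0 ^ 3 + X 1 ^ 3 + X 2 ^ 3 + X 3 ^ 3)
    (v : Spec (.of (MvPolynomial (Fin 5) k ⧸ Ideal.span {f})))
    (hv : v.asIdeal = Ideal.span (Set.range fun j : Fin 5 => Ideal.Quotient.mk (Ideal.span {f}) (X j))) :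
    (IsClosed ({v} : Set (Spec (.of (MvPolynomial (Fin 5) k ⧸ Ideal.span {f})))) ∧
      v ∉ Scheme.regularLocus (Spec (.of (MvPolynomial (Fin 5) k ⧸ Ideal.span {f}))) ∧
      ringKrullDim ((Spec (.of (MvPolynomial (Fin 5) k ⧸ Ideal.span {f}))).presheaf.stalk v) = (4 : ℕ) ∧
      FullCl p ((Spec (.of (MvPolynomial (Fin 5) k ⧸ Ideal.span {f}))).presheaf.stalk v)) ∧
    (∀ (S' : Scheme.{0}) (g : S' ⟶ Spec ((Spec (.of (MvPolynomial (Fin 5) k ⧸ Ideal.span {f}))).presheaf.stalk v)),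
      IsBlowup g ((affineBlowup.idealSheaf (Ideal.span (Set.range (fun j : Fin 5 => Ideal.Quotient.mk (Ideal.span {f}) (X j))))).comap
        ((Spec (.of (MvPolynomial (Fin 5) k ⧸ Ideal.span {f}))).fromSpecStalk v)) →
      ((affineBlowup.idealSheaf (Ideal.span (Set.range (fun j : Fin 5 => Ideal.Quotient.mk (Ideal.span {f}) (X j))))).comap
          ((Spec (.of (MvPolynomial (Fin 5) k ⧸ Ideal.span {f}))).fromSpecStalk v)) ≠ ⊥ ∧
      (((((affineBlowup.idealSheaf (Ideal.span (Set.range (fun j : Fin 5 => Ideal.Quotient.mk (Ideal.span {f}) (X j))))).comap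
          ((Spec (.of (MvPolynomial (Fin 5) k ⧸ Ideal.span {f}))).fromSpecStalk v))).support :
            Set (Spec ((Spec (.of (MvPolynomial (Fin 5) k ⧸ Ideal.span {f}))).presheaf.stalk v))) ⊆
          (Scheme.regularLocus (Spec ((Spec (.of (MvPolynomial (Fin 5) k ⧸ Ideal.span {f}))).presheaf.stalk v)))ᶜ) ∧
      (∀ s : S', g.base s ≠ closedPoint ((Spec (.of (MvPolynomial (Fin 5) k ⧸ Ideal.span {f}))).presheaf.stalk v) → s ∈ Scheme.regularLocus S') ∧
      (∀ s : S', FullCl p (S'.presheaf.stalk s))) ∧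
    TStepGerm.TStepInstanceAt p v ((affineBlowup.idealSheaf (Ideal.span (Set.range fun j : Fin 5 => Ideal.Quotient.mk (Ideal.span {f}) (X j)))).comap
      ((Spec (.of (MvPolynomial (Fin 5) k ⧸ Ideal.span {f}))).fromSpecStalk v)) := by
  obtain ⟨h2, h3⟩ := X2Cubic4Specimen.two_three_ne_zero k p hp2 hp3
  refine ⟨⟨X2Cubic4Specimen.isClosed_vertex k f hf v hv, X2Cubic4Specimen.vertex_not_mem_regularLocus k h3 f hf v hv,
    X2Cubic4Specimen.ringKrullDim_stalk_vertex k h3 f hf v hv, X2Cubic4VertexFull.fullCl_Spec_stalk_vertex k p hp2 hp3 f hf v hv⟩,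
    fun S' g hg => X2Cubic4FloorFull.pointFloor_x2cubic4_legal_full k p h2 h3 f hf v hv S' g hg,
    X2Cubic4FloorTwoGlue.tStepInstanceAt_x2cubic4_origin k h2 h3 p f hf v hv _ rfl⟩

end Summit.ResolutionOfSingularities.ResolutionOfSingularities.Theorems.FInjectiveMacaulayfication.X2Cubic4TStepRow

end
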